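import Mathlib
import HarnessLib
import HarnessLib.Audit
import Summits.Parity.Statement
import Literature.NumberTheory.Sieve.LinearEquationsInPrimes
import HarnessLib.Audit.Status.Attr

/-!
Route: VarianceWitness

# Route VarianceWitness — every Hardy–Littlewood anomaly is witnessed by prime class variance; GHL =
t-uniform inverse theorem ∧ GRH-lite with a log-log rate (rev 3: the rate residual is discharged by
the PROVED amplification door; rev 5: the witness of crux 2 is LOCALIZED to a comparable scale; rev
14: the door is again the provable-now SUPPORT binder UniformDoor — composing it by name, rev 13,
imported seven Theorems modules whose module cone carries 30 unproved Literature facts and blocked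
the route's provers)

BARRIER INVERSION (operator C). Write V_Λ(x; q, τ) := Σ_{b mod q, (b,q)=1} |Σ_{n≤x, n≡b (q)}
Λ(n)n^{−iτ} − (1/φ(q))Σ_{n≤x,(n,q)=1} Λ(n)n^{−iτ}|² for the twisted class variance of the primes (at
τ = 0 this is Fiorilli–Martin's V_Λ(x;q) = (1/φ(q))Σ_{χ≠χ₀}|ψ(x,χ)|²). It suffices to show X =
InverseDicksonUniform ∧ TwistedVarianceRate: InverseDicksonUniform (the DOOR, crux 2,
character-immune by construction) — for every A, L, ε there are κ, δ > 0, C, B and N₀ such that for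
N ≥ N₀ every failure of RELATIVE Dickson–Hardy–Littlewood (|S_Ψ(K) − β_∞𝔖_Ψ| > ε(β_∞𝔖_Ψ + N)) by a
non-degenerate d = 1 system of t ≤ (log log N)^A forms of size ≤ L·t on a convex K ⊆ [−N,N] is
WITNESSED at a comparable scale x ∈ [N, N^B] (rev 5) by a modulus q ≤ x^{1−κ} and a twist |τ| ≤ x
with V_Λ(x;q,τ) ≥ δx²/(φ(q)(log log x)^C) — the constants are UNIFORM in the number of forms, and
the witness threshold is allowed to decay like a power of log log x (the honest shape: a real zero
of some L(s,χ), cond χ ≤ N^{1−κ}, at depth ≍ log log log N/log N — permitted by every known theorem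
— produces ε-anomalies of systems of t_N ≍ (log log N)^A forms aligned mod cond χ whose only witness
has relative size ≍ ε/t_N²); TwistedVarianceRate (the ZERO SIDE, crux 3, "GRH-lite with a rate") —
for every κ, ε > 0 and every B, V_Λ(x;q,τ) ≤ εx²/(φ(q)(log log x)^B) for all x ≥ x₀(κ,ε,B), q ≤
x^{1−κ}, |τ| ≤ x (B = 0 is the rev-2 crux UniformTwistedVariance, at τ = 0 PROVABLY implied by the
typed conjunct — support ClassVarianceOfGHL; GRH gives every B with room). By contraposition through
the witness (proved in glue.lean, 30 lines) the two give S⁺ = UniformRelativeDimOne — relative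
Dickson–Hardy–Littlewood with the Green–Tao Conj. 1.4 error ε(β_∞𝔖 + N), UNIFORM in t ≤ (log log
N)^A (target node; verbatim the residual typed by the strategist census of crux AbsoluteUpgrade and
the statement of LeeYangFibres' Defs file p140471) — and the tree's PROVED amplification door
`Cruxes.AbsoluteUpgrade.UniformAmplification.generalizedHardyLittlewood_of_uniformRelativeDimOne`
(Theorems/LeeYangFibresAbsoluteUpgradeUniformDoor.lean, p146814: tensor-power trick over
translate-constellations + m-uniform Gallagher averaging + the fibration lemma) gives the Statement
— carried in `closes` as the provable-now SUPPORT binder UniformDoor := UniformRelativeDimOne →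
GeneralizedHardyLittlewood (revs 3–12 and again since rev 14; its one-line proof from the landed
door lives in Theorems/, because the door's own file imports this route file through
`LeeYangFibresAbsoluteUpgradeSummit`; land-ready file attached to the item). Rev 13 had instead
composed the door BY NAME from its VarianceWitness-free ingredients (the five uniform-singular-mean
stubs + `stub_amplification` of `Cruxes.AbsoluteUpgrade.UniformAmplification` and
`FibrationGlue.generalizedHardyLittlewood_of_dimOne`), which made `closes` crux-only but required
importing seven LeeYangFibres Theorems modules whose MODULE cone (173 modules) carries 30 unproved
Literature facts (ParityWave0's TwinPrime/EH/Chowla/Goldbach…, MoebiusShiftedPrimesConjecture,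
kowalskiSoundararajan_primeModuliConjecture, bfi_wellFactorable_level, GreenTao2010_gowersUniformity
— none a constant of any item or of `closes`): the priority guardrail `blocked-by-cone (30)` then
kept every prover off the route; rev 14 (route-repair g7) reverts to the light import set (only
`Literature.NumberTheory.Sieve.LinearEquationsInPrimes` beyond the Statement; module cone 10, 0
unproved facts). REV 3 (route-repair 2026-08-17, needs_repair skeleton.hides-summit on the shared
residual stmt-Parity-14116): rev 2 closed through AbsoluteUpgrade := RelativeDimOne → DimOne, whose
every registered line hides the summit (census: no-strategy-short-of-summit; its open stub S⁺ ⟹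
Statement, p146814); the census's door (b) — "any route delivering relative HL with constants
uniform in t ≤ (log log N)^{t₀} discharges 14116 and 0819 for free" — is now a theorem, and on this
route the t-dependence of the output entered ONLY through the inverse theorem's constants (κ, δ,
N₀)(t, L, ε); so the residual is removed by asking the inverse theorem for t-uniform constants and
the zero side for the matching (log log x)^{−B} rate. No declared residual remains: `closes` has as
hypotheses exactly the two cruxes and the provable-now door UniformDoor (a routine support, not a
remainder: its proof is one line from p146814). REV 5–6 (route-repair 2026-08-17): (i) the birth
crux-attack on crux 2 (stmt-Parity-18095) kernel-checked that with the witness allowed at ANY later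
scale x ≥ N the crux was ↔ (TwistedVarianceRate → UniformRelativeDimOne) — one far-away failure of
the zero side witnessed every anomaly for free — so the witness is now LOCALIZED to the window [N,
N^B] (B bound together with κ, δ, C), which removes that free direction and makes the crux say what
is meant: anomalies are zero/character phenomena visible at their own scale (`closes` uses only x ≥
N); (ii) the rev-2 copies DimOne / RelativeDimOne are dropped from this route and AbsoluteUpgrade
survives only as ONE vestigial support decl with both sides inlined (defeq to
LeeYangFibres.AbsoluteUpgrade, sharing no item with the summit-hiding stmt-Parity-14116 any more),
kept solely because the append-only `Theorems/LeeYangFibresAbsoluteUpgradeSummit.lean` imports this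
file and names `Theses.VarianceWitness.AbsoluteUpgrade` — not an obligation of this route. The route
realises no existing card; it is the output of assuming the catalogued walls: every proof of the
typed (shift-uniform) conjunct must kill the illusory world (W3, tree:
`PairsToGHL.Negative.not_generalizedHardyLittlewood_of_unboundedSiegelZeros`) — indeed it must prove
V_Λ(x;q) = o(x²/φ(q)) for every q ≤ x^{1−κ} (support ClassVarianceOfGHL, provable now: "GHL is
GRH-lite-complete") — while its parity input must be sequence-specific and not
weight-insertion-invariant (W1/W2); the inverse-theorem shape is the cut that puts the L-function
content in one separately-staffable crux (necessary at B = 0, τ = 0) and leaves a parity crux that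
is consistent in every known world (in the illusory world and in every "low zeros" world its
conclusion is a theorem of the explicit formula — NOT DECOMPOSED YET records the typed consistency
lemma WitnessAtSiegelScales).
Lean: `InverseDicksonUniform ∧ TwistedVarianceRate`

## Assembly
`closes (hI : InverseDicksonUniform) (hV : TwistedVarianceRate) (hD : UniformDoor) :
GeneralizedHardyLittlewood := hD (…)` (rev 14, glue.lean, lean check rc 0, axioms
propext/Classical.choice/Quot.sound): `refine hD ?_` and then S⁺ = UniformRelativeDimOne by
contraposition through the witness — given (A, L, ε) take (κ, δ, C, B, N₀) from hI and x₀ from hV at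
(κ, δ/2, B := C); for N ≥ max(N₀, x₀, 3) an anomaly of a t-system, t ≤ (log log N)^A, would produce
x ∈ [N, N^B], x ≥ N ≥ 3 (so log log x > 0), q ≤ x^(1−κ), |τ| ≤ x with δx²/(φ(q)(log log x)^C) ≤ V ≤
(δ/2)x²/(φ(q)(log log x)^C), absurd (verbatim the statement of the support
UniformRelativeDimOneOfCruxes and the registered redirect skeleton's `UniformRelativeDimOne_of` on
stmt-Parity-18098). Binders: the two OPEN cruxes (both used) and the provable-now support
UniformDoor (used; class `proved` as soon as Theorems/VarianceWitnessUniformDoor.lean lands — `fun h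
=> Cruxes.AbsoluteUpgrade.UniformAmplification.generalizedHardyLittlewood_of_uniformRelativeDimOne
h`, the two copies of S⁺ agreeing by `Iff.rfl`); the assembly ITEM stays `InverseDicksonUniform →
TwistedVarianceRate → GeneralizedHardyLittlewood` (cruxes → Statement), closed by `fun hI hV =>
closes hI hV uniformDoor_holds` right after the door lands. Rev 13's crux-only variant (door
composed by name from seven imported LeeYangFibres Theorems modules) is recorded in git and in the
REV-14 LEDGER paragraph; it is equivalent in content and was reverted only for its import cone.

Rationale: WHY THIS LINE. Every open route meets the Siegel wall inside a monolithic shift-uniform crux or a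
declared residual ("Landau–Siegel-complete": PairsToGHL, EngineToGHL, ResidualLift, ChowlaNatural,
DiscGrowth…), and the closed Siegel cards (siegel-hardness-uniform-ghl,
summit-implies-landau-siegel: graded known, "UniformityLift has no mechanism") proposed no X → GHL.
Here the mechanism of the uniformity lift IS the crux: a STRUCTURE THEOREM ("anomaly ⟹ arithmetic
witness") of the kind the multiplicative-function community proves — Tao's inverse/entropy-decrement
theorem and the Tao–Teräväinen structure theorem for correlations (TaoFMP2016,
TaoTeravainenDuke2019, TaoTeravainen2019AlmostAllScales), Matomäki–Radziwiłł–Tao–Teräväinen–Ziegler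
higher uniformity in short intervals at NATURAL density (MatomakiEtAl2020), Helfgott–Radziwiłł,
Pilatte2026 — transplanted from λ-correlations to Λ-tuples, with the witness allowed to have growing
conductor (the only consistent form under shift-uniformity: MatomakiMerikoski2023 Thm 1.3 exhibits
anomalies at h = 2q witnessed by χ mod q = N^{1/10}) and — rev 3 — with constants uniform in the
number of forms t ≤ (log log N)^A and a witness threshold decaying like (log log x)^{−C} (the only
consistent form under t-uniformity: a real zero at depth ≍ log log log N/log N, allowed by every
known theorem and by zero-density up to (log log N)^{O(1)} copies, gives t_N-form anomalies aligned
mod q — relative size ≈ ((1+u)^{t}+(1−u)^{t})/2 − 1 ≈ t²u²/2, u = N^{β−1} — witnessed only at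
relative size u² ≈ 2ε/t²). The zero side imports the L-function theory of primes in progressions
(Gallagher1970, Linnik, log-free density, GoldstonSuriajaya2021 §7, FiorilliMartin2020's V_Λ,
Hooley's BDH series) as a crux that is provably NECESSARY at (B, τ) = (0, 0) and attackable on its
own (known for q ≤ (log x)^A, for non-exceptional q ≤ x^{κ(ε)} by Gallagher, under GRH for every B
with room x(log x)^4 ≪ x²/(φ(q)(log log x)^B), and for special moduli with wider zero-free regions).
The t-uniform OUTPUT S⁺ is turned into the Statement by a theorem of the tree proved today
(amplification door (b) of the strategist census of crux AbsoluteUpgrade: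
`dimOne_of_uniformRelativeDimOne`, `generalizedHardyLittlewood_of_uniformRelativeDimOne`,
Theorems/LeeYangFibresAbsoluteUpgradeUniformDoor.lean, p146814; m-uniform Gallagher averaging over
translate-constellations + (m+1)-th root extraction beats the maximal singular mass (e^γ log log
N)^{t−1}). What the line does that prior routes do not: it splits the conjunct into two pieces,
neither of which gives the Statement alone, with the parity piece immune to the illusory world and
to every "low zeros" world, and the zero piece explicit, necessary at its base case and GRH-implied
at every level — exactly the shape the barrier catalogue forces — and (rev 3) it carries NO declared
residual: the (log log N)^{t−1} rate gap that every d = 1 relative route leaves open (LeeYangFibres'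
AbsoluteUpgrade, 10 lead seats blocked-on stmt-Parity-0819) is paid here in the currency the inverse
theorem naturally has — uniformity of its constants in t.

RANKED CRUXES. #0 UniformRelativeDimOne (target) — S⁺: relative Dickson–Hardy–Littlewood with the
Green–Tao Conj. 1.4 error ε(archFactor·singularProduct + N), UNIFORM in the number of forms 1 ≤ t ≤
(log log N)^A (sizes ≤ L·t, convex K ⊆ [−N,N]; verbatim
`Cruxes.AbsoluteUpgrade.UniformAmplification.UniformRelativeDimOne`). The route's d = 1 output,
reached as the contrapositive of cruxes 2 ∧ 3; ⟹ Statement by the door (UniformDoor); at least as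
strong as the Statement (not to be staffed directly). (why it might fail: contains prime k-tuples
uniform in k ≤ (log log N)^A, Goldbach/twins to relative o(1), and shift-uniformity
(Landau–Siegel-complete); beyond the Statement it forbids real zeros at depth O(log log log q/log
q).) [GreenTao2010, Gallagher1976, MatomakiMerikoski2023,
Theorems/LeeYangFibresAbsoluteUpgradeUniformDoor.lean]
#2 InverseDicksonUniform (crux; rev 5 = stmt-Parity-17969, LOCAL witness) — every ε-anomaly of
relative Dickson–HL for a t-system at scale N, t ≤ (log log N)^A, is witnessed at a comparable scale
x ∈ [N, N^B] by q ≤ x^{1−κ}, |τ| ≤ x with V_Λ(x;q,τ) ≥ δx²/(φ(q)(log log x)^C), constants uniform in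
t. (relative Dickson–Hardy–Littlewood anomalies are character-witnessed at their own scale, with
constants uniform in the number of forms; vacuous in the Hardy–Littlewood world (S⁺ true), and its
conclusion is a theorem of the explicit formula in the illusory world and in every world whose
anomalies come from zeros of L-functions of conductor ≤ x^{1−κ}, height ≤ x. HONEST POSITION (rev
5): S⁺ ⟹ crux 2 (vacuity) ⟹ (TwistedVarianceRate → S⁺) (planner Sketch.lean); the rev-3 body,
witness at any x ≥ N, was kernel-checked EQUIVALENT to that bridge implication (refuter,
InverseDicksonUniformIff.lean on stmt-Parity-18095) — the window [N, N^B] is exactly what separates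
them; under TwistedVarianceRate (so under GRH) crux 2 coincides with S⁺, hence its standalone
content is the exclusion of WITNESS-FREE (pure-parity) anomalies and any proof must be Λ/λ-specific;
the modulus is deliberately neither tied to Ψ nor capped at (log N)^B — exceptional-character
corrections hit non-aligned systems (HeathBrown1983PrimeTwins) at conductor N^{1/10}
(MatomakiMerikoski2023), and B = 2 covers conductors up to L·t·N.) [difficulty: open-problem] (why
it might fail: a pure-parity HL failure (λ non-pretentious: anomaly at scale N with quiet class
variance on [N, N^B]) refutes it; known inverse/structure theorems lose exp(t) in the number of
forms, here t ≤ (log log N)^A → ∞, and need log-averaging / EH-type level inputs at natural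
density.) [TaoFMP2016, TaoTeravainenDuke2019, TaoTeravainen2019AlmostAllScales, MatomakiEtAl2020,
MatomakiMerikoski2023, TaoTeravainen2021, HeathBrown1983PrimeTwins]
#3 TwistedVarianceRate (crux) — V_Λ(x;q,τ) ≤ ε x²/(φ(q)(log log x)^B) for all large x, q ≤ x^{1−κ},
|τ| ≤ x, every B ("individual-modulus Barban–Davenport–Halberstam with a log-log rate", twisted; B =
0 is rev 2's UniformTwistedVariance, at τ = 0 PROVABLY implied by the typed conjunct — support
ClassVarianceOfGHL — and refuting UnboundedSiegelZeros; GRH gives every B with room x^{1−κ}(log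
x)^4(log log x)^B; in zero language, morally: no zeros of L(s,χ), cond χ ≤ x^{1−κ}, |γ| ≤ x, with
(1−β)·log x = O(log log log x)). [difficulty: open-problem] (why it might fail: contains
Landau–Siegel (exceptional χ mod q = x^{1/10} gives V ≍ x²/φ(q)) and more: (log q)^C zeros at 1 −
O(log log q/log q), or ONE zero at 1 − A log log log q/log q + iτ₀, cond ≤ x^{1−κ}, |τ₀| ≤ x, breaks
it; open for every q > exp((log x)^{1/2}).) [Gallagher1970, GoldstonSuriajaya2021,
FiorilliMartin2020, Hooley1975BDH1, FriedlanderGranvilleHildebrandMaier1991, MontgomeryVaughan2007]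
#9 ClassVarianceOfGHL (support) — THE CERTIFIED WALL (provable now, M/L): the typed conjunct implies
the untwisted class-variance law V_Λ(x;q) ≤ εx²/φ(q) for all q ≤ x^{1−κ} (Goldston–Suriajaya
identity `Literature.Barriers.Parity.residueSquareSum_eq` + GHL at (d,t,L) = (1,2,3) on the pairs
(n, n+k), q ∣ k + the singular-series mean value (GS2021 (Slast); upper half in tree) + Σ_{n≤x}Λ(n)²
≤ (x+1)log²x + ψ(x) ∼ x). Not a binder of `closes`; it certifies that crux 3 at (B, τ) = (0, 0) is
NECESSARY ("GHL is GRH-lite-complete"). [difficulty: provable-now] [GoldstonSuriajaya2021,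
GreenTao2010, FiorilliMartin2020]
#9 UniformDoor (support; revs 3–12, restored rev 14) — THE AMPLIFICATION DOOR (provable now, ONE
line): UniformRelativeDimOne → GeneralizedHardyLittlewood by the landed
`Cruxes.AbsoluteUpgrade.UniformAmplification.generalizedHardyLittlewood_of_uniformRelativeDimOne`
(p146814; the two copies of S⁺ agree by `Iff.rfl`). A binder of `closes`, not a by-name call,
because the door's file imports this route file; LAND IT FIRST (land-ready Theorems file attached to
the item) — it makes the only non-crux hypothesis of `closes` class proved. [difficulty:
provable-now] [GreenTao2010, Theorems/LeeYangFibresAbsoluteUpgradeUniformDoor.lean]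
#1 Assembly (assembly) — InverseDicksonUniform → TwistedVarianceRate → GeneralizedHardyLittlewood
(cruxes → Statement; `closes` binds in addition the provable-now door UniformDoor, so the item
closes as `fun hI hV => closes hI hV uniformDoor_holds` the moment the door lands).
REVISION LEDGER (full notes: `ledger route show` + git history). Rev 3 (rbadge g0): rev-2 cruxes
superseded 1:1 by their t-uniform forms (InverseDickson 17129 → InverseDicksonUniform,
UniformTwistedVariance 17130 → TwistedVarianceRate; the fixed-t / B = 0 cases stay
true-if-the-new-ones-are, nothing refuted), target S⁺ and the provable-now door binder UniformDoor
added, FibrationLemma 17131 dropped (absorbed), LeeYangFibres' copies DimOne 0819 / RelativeDimOne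
14113 / AbsoluteUpgrade 14116 re-badged vestigial support out of the cone. Rev 5–6 (g2): crux 2
LOCALIZED (18095 → 17969, same decl name) after the birth crux-attack's kernel-checked iff; DimOne
and RelativeDimOne dropped; the shared summit-hiding AbsoluteUpgrade entry 14116 replaced by the
inlined vestigial link decl 17986 (∀-form defeq to LeeYangFibres.AbsoluteUpgrade, rc 0 against the
three `varianceWitness_*` theorems; kept only for the append-only
Theorems/LeeYangFibresAbsoluteUpgradeSummit.lean; `aside` not renderable on this gate). Rev 12 (g5):
redirect glue UniformRelativeDimOneOfCruxes 18115 added; redirect skeleton registered on the target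
18098. Rev 13 (g6): door composed BY NAME from seven imported LeeYangFibres Theorems modules,
UniformDoor 18099 dropped, Assembly restated to crux-only (18097 → 18100). Rev 14 (g7, THIS REPAIR;
payload `blocked-by-cone`: 30 unproved named facts in the route's IMPORT cone): all 30 (ParityWave0:
TwinPrime/EH/Chowla/Goldbach/Landau/Schinzel/Bunyakovsky/Dickson/Sarnak + goldbach*/liouville facts;
MoebiusShiftedPrimesConjecture; kowalskiSoundararajan_primeModuliConjecture,
dukeFriedlanderIwaniecToth_quadraticRoots_primeModuli; bfi_wellFactorable_level;
GreenTao2010_gowersUniformity) ride in ONLY on those seven rev-13 imports (closures of 101–132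
modules via PairShiuRough → … → ParityWave0 / MoebiusShiftedPrimes / PolynomialCongruences /
LevelOfDistribution; FibrationLemmaFinal → … → Transference); none is a constant of any item or of
`closes` (gate cone 25 constants, 0 unproved: READY) — but the prover guardrail `require_clean_cone`
reads the MODULE cone. The pre-rev-13 import set {Summits.Parity.Statement,
Literature.NumberTheory.Sieve.LinearEquationsInPrimes} closes over 10 modules with none of those
files (walked this session; cf. the 01:22Z cone fix removing Barriers.Parity.SiegelZeroPrimePairs).
REPAIR (a): 7 imports dropped; door restored as the provable-now support binder UniformDoor
(statement of revs 3–12); `closes (hI) (hV) (hD : UniformDoor) := hD (contraposition)` re-certified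
(Sketch.lean rc 0; gate native on edit); Assembly 18100, cruxes, target, other supports unchanged (0
restated); needs-fact: NONE. Do NOT re-revert: crux-only-by-name costs `blocked-by-cone (30)`, the
binder costs ONE routine Theorems line (land-ready file attached to the item) — landing it gives a
crux-only-in-effect `closes` (binder class proved); or an operator-lane import-hygiene pass
(PairShiuLocal ↛ … ↛ ParityWave0) makes the by-name form free. The `skeleton.hides-summit`
needs_repair entry (stub_uniformRelativeDimOne of stmt-Parity-14116) is STALE since 08:42Z (the stub
left 14116's skeleton, c11; 14116 replaced/off-cone here since rev 6/10; the mark's routes list is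
frozen at 07:36Z) and operator-only to clear: `ledger stub-summit probe stmt-Parity-14116` (refused
for planners g3–g7; `route relint`: hold null, cleared false).
TWO-LAYER PLAN. InverseDicksonUniform ⇐ InversePretentiousUniform → PretentiousRigidity →
InverseDicksonUniform (k = 2; the rev-2 BC3 skeleton bc/InverseDickson_birth.lean composes with the
extra binders A, t): InversePretentiousUniform = "a relative anomaly of a t-system at scale N, t ≤
(log log N)^A, makes λ pretend to a twisted character of conductor ≤ C·N, height ≤ C·N, at
pretentious distance ≤ D(A,L,ε) + C log log log N" (the structure theorem proper: Λ ↔ λ dictionary +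
Elliott-type inverse theorem at natural density, with the loss in t made explicit);
PretentiousRigidity = "a pretentious witness at scale N propagates to a variance witness V ≥
δx²/(φ(q)(log log x)^C) at some x ∈ [N, N^B], modulus ≤ x^(1−κ)" (explicit formula /
Deuring–Heilbronn rigidity; the log-log loss in distance is exactly a power of log log in V).
TwistedVarianceRate ⇐ SmallModuli(q ≤ x^κ₀: Gallagher + Landau–Siegel + the low-zero box) →
LargeModuli(x^κ₀ < q ≤ x^(1−κ): expanding zero-free box of width g·log log log/log at height ≤ x) →
TwistedVarianceRate (the rev-2 composition bc/UniformTwistedVariance_birth.lean with the rate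
threaded through). First case to attack on crux 2: t = 2, A = 0·(fixed t) — i.e. rev 2's
InverseDickson for pairs — not a separate item (decoration).

KILL CRITERIA. ¬TwistedVarianceRate at any (q, τ, B) — a proved cluster/off-axis/moderately-low zero
phenomenon (zeros of L(s,χ), cond χ → ∞, at depth O(log log log q/log q)), or of course
UnboundedSiegelZeros — closes the route `refuted:TwistedVarianceRate` (and, at (B,τ) = (0,0),
refutes the sub-problem itself via ClassVarianceOfGHL). ¬InverseDicksonUniform requires exhibiting
relative HL anomalies of t_N-systems WITHOUT a variance witness of relative size (log log)^{−O(1)}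
at any comparable scale x ∈ [N, N^B], for every B: substantive, close
`refuted:InverseDicksonUniform`, and the witness-free anomaly is then a new barrier entry (a
pure-parity conspiracy of the primes). A disprover theorem `InverseDicksonUniform_false_without_C`
(constant threshold δx²/φ(q) refuted from a low-zeros hypothesis H) or `_false_without_τ` is
EXPECTED and informative, not a closure: the decaying threshold and the twist are exactly the
repairs already built in (possible for the rev-5 LOCAL body; for the rev-3 body ¬I ⟺
TwistedVarianceRate ∧ ¬S⁺). A proof elsewhere of UniformRelativeDimOne or of DimOne moots everything
(door + `summit_iff_dimOne`).

NOT DECOMPOSED YET. The Λ ↔ λ dictionary inside InversePretentiousUniform (which opening: Liouville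
opening at truncation N^θ with tθ < ½ — note t grows, so θ = θ(N) → 0 slowly —, Bombieri's sieve on
the last form, or Heath-Brown with λ whole; each needs level-of-distribution inputs of EH shape for
λ⊗…⊗λ sequences, to be filed as layer-2 children with the line that uses them); the quantitative
dependence δ(ε) and C(A) (structure theorems give δ = exp(−ε^(−O(1))); the heuristic C(A) = 2A +
3c₁A with c₁ the log-free zero-density exponent); the τ-range (|τ| ≤ x suffices for the glue; |τ| ≤
x^A changes nothing); the WEAKER output that also suffices: the landed transfer
`stub_amplificationFromTranslates` (p146913, door (b′)) needs relative HL only for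
TRANSLATE-CONSTELLATIONS Ψ^{(H)} of bounded-size t₀-systems, uniform in (m+1)t₀ ≤ (log log N)^A
(`TranslateUniformRelativeDimOne`) — an inverse theorem restricted to translate families (anomalies
of (m+1)-point correlations of F = ∏_i Λ∘ψ_i along shifts H) would do and is the natural first
special case of crux 2 at large t; deliberately NOT filed as an item now (vocabulary lives in
LeeYangFibres' Defs files; file it as a glued split of InverseDicksonUniform when a line wants it);
the rev-2 fixed-t statements InverseDickson / UniformTwistedVariance (still true if the new cruxes
are; their contrapositive RelativeDimOne is LeeYangFibres' node stmt-Parity-14113); the consistency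
certificate WitnessAtSiegelScales — `MatomakiMerikoski2023_pairCorrelation → ∃ η₀, ∀ q ≥ 3, ∀ χ mod
q primitive quadratic, ∀ η ≥ η₀, L(1 − 1/(η log q), χ) = 0 → q^22/(4φ(q)) ≤ V_Λ(q^11; q)` — typed
and elaborated in the rev-2 planner's Sketch.lean, provable (L) by running residueSquareSum_eq
backwards; not an item because a cite-only constant in an item statement makes the route unstaffable
(a prover may land it under Theorems/ citing the fact as a hypothesis); BC3 birth skeletons for the
two cruxes stmt-Parity-17969 / 18096 (the target's BC2 redirect S⁺ ⇐ crux 2 ∧ crux 3 is registered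
on stmt-Parity-18098 since rev 12, assembly `UniformRelativeDimOne_of` proved) — left to the crux
seats.

CHEAPEST FALSIFIER. For crux 3: the literature check that no oscillation theorem reaches relative
size (log log x)^{−B} for q ≤ x^(1−κ) — RUN (rev 2, re-read for the rate): FiorilliMartin2020 Thm
1.2 gives V_Λ(x;q) as large as x(log q + log log log x)²/4 only for q ≍ log log x (three orders
below x²/(φ(q)(log log x)^B)); FriedlanderGranvilleHildebrandMaier1991 / Friedlander–Granville
Maier-matrix irregularities of relative size Ω(1) need q > x/(log x)^B′, outside q ≤ x^(1−κ); GRH ⟹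
crux 3 for every B — survives. For crux 2: the disprover's first probes are the witness SHAPE — drop
the (log log x)^{−C} decay (a low-zeros hypothesis H: real zeros of quadratic L(s,χ_q), q → ∞, at 1
− A log log log q/log q, should give `H → ¬(InverseDicksonUniform with C = 0)` — expected,
informative: it certifies the decay is load-bearing) and drop τ (an off-axis zero β = 1 − u/log q, 1
≤ |t₀| ≤ N/q creates anomalies at shifts ≡ 0 mod q, h ≤ N/|t₀|, with no untwisted witness: expected
`_false_without_τ`); and the in-Lean check that the A = 0 (t = 1) case is vacuous (PNT in
progressions of bounded modulus). RUN at birth (refuter-rattack-stmt-Parity-18095, 2026-08-17): the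
logical probe `crux 2 ↔ (crux 3 → target)?` — TRUE for the rev-3 body (kernel-checked), which is why
rev 5 localizes the witness; for the rev-5 body the free direction would need a variance failure
inside EVERY window [N, N^B] around anomalous N, which ¬TwistedVarianceRate does not supply (planner
Sketch.lean proves only S⁺ → crux 2 → (crux 3 → S⁺)). Glue: `lean check` rc 0 on the planners'
Sketch.lean (rev 5 and rev 14 shapes) and `#h21_crux_probe` CLEAN on both cruxes (bc/probe.lean, rev
5).

NUMBERS. V_Λ(x;q) baselines: Poisson/Hooley size x log q (Hooley's conjecture, false for q ≍ log log
x: FiorilliMartin2020 Thm 1.1–1.2); GRH: V_Λ ≤ x(log x)^4; Brun–Titchmarsh: V_Λ ≤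
(2/κ)(1+o(1))x²/φ(q) for q ≤ x^(1−κ) (so crux 3 improves the BT constant to o((log log x)^{−B}));
Gallagher1970 Thm 7: relative bias O(exp(−c log x/log q)) + Siegel term for q ≤ x^c — crux 3 is
KNOWN only for non-exceptional q ≤ x^(κ(ε,B)/log log log x); the gap to x^{1−κ} is the expanding
zero-free box. Amplification numbers (landed): m + 1 = ⌈(log log N)^{t−1}⌉ translates, mass
threshold 5N, maximal singular mass (e^γ log log N)^{t−1} (p90245, p86331). Illusory world:
V_Λ(q^11; q) ≥ q^22/(4φ(q)) (WitnessAtSiegelScales, folder lemma). Low-zeros world: one real zero at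
1 − β = (log(t²/2ε))/(2 log N) for χ mod q ≤ N^{1−κ} ⟹ relative anomaly ε for the t-system (n +
jq)_{j<t} at scale N, witness V_Λ(N;q) ≈ (2ε/t²)N²/φ(q) — the calibration of C ≥ 2A. Items after rev
14: 8 — target UniformRelativeDimOne; cruxes InverseDicksonUniform 2 (stmt-Parity-17969),
TwistedVarianceRate 3; supports UniformDoor (ONE line, the only non-crux binder of `closes` — land
first), ClassVarianceOfGHL (certificate), UniformRelativeDimOneOfCruxes (redirect glue) — all
provable now — and the vestigial AbsoluteUpgrade (stmt-Parity-17986, off-cone, not staffed);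
assembly (cruxes → Statement). Module cone of the route file: 10 modules, 0 unproved Literature
facts (rev 13: 173 modules, 30).

DEFINITION REQUESTS. None: AffLinForm/vonMangoldtSum/archFactor/singularProduct
(Literature.NumberTheory.Sieve), pretentiousDistSq/twistedChar (for the layer-2 children),
MatomakiMerikoski2023_pairCorrelation, residueSquareSum (Literature.Barriers.Parity), and the door
`Cruxes.AbsoluteUpgrade.UniformAmplification.generalizedHardyLittlewood_of_uniformRelativeDimOne`
(Theorems; its file imports this route file, so it enters `closes` as the provable-now support
binder UniformDoor, proved in one line under Theorems/) all exist; V_Λ is inlined (Finset form) in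
every item.

Novelty: Searches (2026-08-17): `lit search --source s2 "Barban-Davenport-Halberstam theorem individual
moduli"` (6: Hooley I–XIX, Cai–Duan–Jiang 2026 automorphic BDH), `lit search --source s2 "Fiorilli
variance primes arithmetic progressions"` (6: Fiorilli 2013 IMRN, FiorilliMartin2020 =
arXiv:2008.05837 READ pp.1–3, Hayani 2024, Bretèche–Fiorilli 2020), `lit search --source crossref
"Refinements of Goldbach's conjecture and the generalized Riemann hypothesis"` (Granville2007 +
corrigendum), `lit search --source arxiv "Hardy-Littlewood Chowla Siegel zero Tao Teravainen"`
(TaoTeravainen2021), `lit read arxiv:2104.09407` (GoldstonSuriajaya2021 §7 READ: identity (Tq),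
lemma (Slast)), `lit galaxy search "Siegel zero" --star pdf` (8, none on uniform HL ⟹ variance),
local `lit search`/`lit vsearch` daemon unavailable this session (ConnectionReset; noted), `lean
search` for GeneralizedHardyLittlewood ∧ Siegel (tree:
PairsToGHL.Negative.not_generalizedHardyLittlewood_of_unboundedSiegelZeros, residueSquareSum_eq,
SiegelZeroPrimePairBarrier_holds), `ledger negatives --problem Parity` (3, none of this shape), all
33 Theses files and the 121 cards of the sub (closed Siegel cards graded known:
siegel-hardness-uniform-ghl, summit-implies-landau-siegel, siegel-negative-bridge; declined
siegel-or-survivors).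
Nearest prior art found: GoldstonSuriajaya2021 §7 (the identity; they extract log²-repulsion from
the UPPER-bound conjecture only) and Granville2007 Thm 1A (averaged Goldbach with power error ⟺  [refs: 2008.05837, 2104.09407, arxiv:2104.09407, FiorilliMartin2020, Granville2007, TaoTeravainen2021, GoldstonSuriajaya2021, MatomakiMerikoski2023, TaoTeravainenDuke2019, FriedlanderGranville1992]

Barriers (technique_class: inverse-theorem, class-variance, zero-side-separation): - technique_class: inverse-theorem, class-variance, zero-side-separation
- Literature.Barriers.Parity.SiegelZeroPrimePairBarrier: evaded BY CONSTRUCTION — in the illusory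
world (and in every low-zeros world) InverseDicksonUniform's conclusion holds by the explicit
formula (folder lemma WitnessAtSiegelScales; the (log log x)^{−C} threshold is calibrated on the
aligned-mod-q anomalies of a zero at depth log log log q/log q) and the whole Siegel content sits in
crux 3, which is provably necessary (ClassVarianceOfGHL); nothing Siegel-inert is asked to imply
something Siegel-effective.
- Literature.Barriers.Parity.SiegelZeroTwinPrimes: same; the route never uses a dueling-conspiracies
step — crux 3 is to be PROVED, not bypassed.
- Literature.Barriers.Parity.BrunTitchmarshSiegelZero: crux 3 is an improvement of the
Brun–Titchmarsh constant to o(1) in quadratic mean over classes and therefore DOES repel exceptional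
zeros — consistent: that is its declared job (it refutes UnboundedSiegelZeros), not a hidden cost.
- Literature.Barriers.Parity.SelbergParityBarrier: no sieve deduction from Type-I data occurs;
InverseDicksonUniform is a statement about Λ specifically (any proof opens Λ and uses complete
multiplicativity of λ), outside the class `no_typeI_prime_lower_bound_allModuli`.
- Literature.Barriers.Parity.PrimePairParity: the weight-insertion schema needs the inputs to hold
for the ghost-weighted sequence Λ(n)Λ(n+2)(1−λ(n)λ(n+2)); InverseDicksonUniform is not an input
class closed

History (route lifecycle, newest last):
- 2026-08-17T09:32:55Z · rev 6: restated AbsoluteUpgrade (stmt-Parity-14116) — rev-6 repair step B (needs_repair skeleton.hides-summit on shared stmt-Parity-14116; `aside` retriage unavailable on this gate: KeyError): detach this route fro (planner-rbadge-Parity-VarianceWitness-75000cea-g2-0)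
- 2026-08-17T09:32:55Z · rev 6: dropped DimOne, RelativeDimOne — rev-6 repair step B (needs_repair skeleton.hides-summit on shared stmt-Parity-14116; `aside` retriage unavailable on this gate: KeyError): detach this route fro (planner-rbadge-Parity-VarianceWitness-75000cea-g2-0)
- 2026-08-17T09:38:38Z · rev 6: dropped stmt-Parity-17977 — rev-6 repair step B″ (gate KeyError('aside') wedge): drop the unrenderable `aside` entry stmt-Parity-17977 and re-add the SAME vestigial link decl AbsoluteUpgra (planner-rbadge-Parity-VarianceWitness-75000cea-g2-0)
- 2026-08-17T11:07:25Z · rev 10: dropped stmt-Parity-14116 — rev-7 route-repair (rbadge g4, needs_repair skeleton.hides-summit on stmt-Parity-14116): drop the REPLACED wanted_by/structure record of stmt-Parity-14116 itsel (planner-rbadge-Parity-VarianceWitness-75000cea-g4-0)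
- 2026-08-17T12:37:37Z · rev 13: restated Assembly (stmt-Parity-18097) — rev-13 route-repair (rbadge g6): RE-GLUE so `closes` binds ONLY the two cruxes — the amplification door S⁺ → DimOne → Statement is composed BY NAME from landed, (planner-rbadge-Parity-VarianceWitness-75000cea-g6-0)
- 2026-08-17T12:37:37Z · rev 13: dropped UniformDoor — rev-13 route-repair (rbadge g6): RE-GLUE so `closes` binds ONLY the two cruxes — the amplification door S⁺ → DimOne → Statement is composed BY NAME from landed, (planner-rbadge-Parity-VarianceWitness-75000cea-g6-0)
- 2026-08-24T11:48:27Z · DORMANT — reconciler: no traction for 6.7 d (last activity item-evidence-added at 2026-08-17T17:16:53Z); parked, not closed — `ledger route dormant route-Parity-VarianceW (operator:999:3653521)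
- 2026-08-30T06:28:20Z · REACTIVATED — reconciler: reactivated — activity item-evidence-added at 2026-08-30T05:19:57Z after parking at 2026-08-24T11:48:27Z (operator:999:2915060)

sub-problem: GeneralizedHardyLittlewood · status: open · opened planner-plan-novel-Parity-GeneralizedHardyLittl-03955878-c-v2-g14-0 2026-08-17T01:16:11Z · rev 14 · ledger route-Parity-VarianceWitness
GENERATED by the gate from the ledger (D-0016/17). Provers cite these decls: `theorem foo : Summit.Parity.GeneralizedHardyLittlewood.Theses.VarianceWitness.<Decl> := …` in Summits/Parity/GeneralizedHardyLittlewood/Theorems/<Name>.lean.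
-/

namespace Summit.Parity.GeneralizedHardyLittlewood.Theses.VarianceWitness

open scoped BigOperators Topology Manifold Classical MeasureTheory ProbabilityTheory Matrix InnerProductSpace ComplexConjugate ContinuousMap
open Filter Set Function TopologicalSpace MeasureTheory

attribute [summit_statement] _root_.GeneralizedHardyLittlewood

/-- item stmt-Parity-18098 · target · rank 0 · open · by planner
why it might fail: ≥ the Statement (landed door) and beyond it: forbids real zeros of L(s,χ) at depth O(log log log q/log q); contains prime k-tuples uniform in k ≤ (log log N)^A and shift-uniformity (Landau–Siegel-complete).
sources: GreenTao2010, Gallagher1976, MatomakiMerikoski2023, Summits/Parity/GeneralizedHardyLittlewood/Theorems/LeeYangFibresAbsoluteUpgradeUniformDoor.lean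
[target] S⁺ = t-UNIFORM relative Dickson–Hardy–Littlewood: for all A, L, ε there is N₀ such that for
N ≥ N₀, all 1 ≤ t ≤ (log log N)^A, all non-degenerate d = 1 systems Ψ of t forms with ‖Ψ‖_N ≤ L·t
and all convex K ⊆ [−N,N]: |vonMangoldtSum Ψ K N − archFactor·singularProduct| ≤
ε(archFactor·singularProduct + N) (Green–Tao Conj. 1.4 error shape, uniform in the number of forms;
verbatim the body of `Cruxes.AbsoluteUpgrade.UniformAmplification.UniformRelativeDimOne`,
LeeYangFibres Defs p140471). The route's d = 1 OUTPUT NODE: reached in `closes` as the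
contrapositive of InverseDicksonUniform ∧ TwistedVarianceRate, and turned into the Statement by the
LANDED amplification door `generalizedHardyLittlewood_of_uniformRelativeDimOne` (p146814; ⟹ DimOne =
stmt-Parity-0819 by `dimOne_of_uniformRelativeDimOne`). At least as strong as the Statement — NOT to
be staffed directly on this route. [deps: InverseDicksonUniform, TwistedVarianceRate] [difficulty:
open-problem] -/
@[route_item "route-Parity-VarianceWitness"]
def UniformRelativeDimOne : Prop :=
  ∀ (A L : ℕ), ∀ ε : ℝ, 0 < ε → ∃ N₀ : ℕ, ∀ N : ℕ, N₀ ≤ N → ∀ t : ℕ, 1 ≤ t → (t : ℝ) ≤ Real.log (Real.log N) ^ A → ∀ Ψ : Fin t → Literature.NumberTheory.Sieve.AffLinForm 1, Literature.NumberTheory.Sieve.IsNondegenerateSystem Ψ → Literature.NumberTheory.Sieve.affLinSize Ψ N ≤ L * t → ∀ K : Set (Fin 1 → ℝ), Convex ℝ K → K ⊆ Literature.NumberTheory.Sieve.realBox 1 N → |Literature.NumberTheory.Sieve.vonMangoldtSum Ψ K N - Literature.NumberTheory.Sieve.archFactor Ψ K * Literature.NumberTheory.Sieve.singularProduct Ψ|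 ≤ ε * (Literature.NumberTheory.Sieve.archFactor Ψ K * Literature.NumberTheory.Sieve.singularProduct Ψ + N)

-- earlier InverseDicksonUniform (stmt-Parity-18095, replaced 2026-08-17T09:26:39Z -> stmt-Parity-17969): retired by None — ∀ (A L : ℕ), ∀ ε : ℝ, 0 < ε → ∃ κ : ℝ, 0 < κ ∧ ∃ δ : ℝ, 0 < δ ∧ ∃ C : ℕ, ∃ N₀ : ℕ, ∀ N : ℕ, N₀ ≤ N → ∀ t : ℕ, 1 ≤ t → (t : ℝ) ≤ Real.log (Real.log N) ^ A → ∀ Ψ : Fin t → Literature.NumberTheory.Sieve.AffLinForm 1, Literature.NumberTheory.Sieve.IsNondegenerateSystem Ψ → Literatur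
/-- item stmt-Parity-17969 · crux · rank 2 · open · by planner
why it might fail: a pure-parity HL failure (λ non-pretentious: a relative anomaly at scale N with quiet twisted class variance on every window [N, N^B]) refutes it; known inverse/structure theorems lose exp(t) in the number of forms (t ≤ (log log N)^A → ∞) and need EH-type level inputs at natural density.
sources: TaoFMP2016, TaoTeravainenDuke2019, TaoTeravainen2019AlmostAllScales, MatomakiEtAl2020, MatomakiMerikoski2023, TaoTeravainen2021
[crux] LOCAL t-UNIFORM INVERSE THEOREM (the door; rev 5): for all A, L, ε > 0 there are κ, δ > 0, C,
B and N₀ such that for N ≥ N₀, every t with 1 ≤ t ≤ (log log N)^A, every non-degenerate d = 1 system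
Ψ of t forms with ‖Ψ‖_N ≤ L·t and every convex K ⊆ [−N,N] with |vonMangoldtSum Ψ K N −
archFactor·singularProduct| > ε(archFactor·singularProduct + N) admit a witness AT A COMPARABLE
SCALE: x ∈ [N, N^B], 1 ≤ q ≤ x^{1−κ}, |τ| ≤ x with V_Λ(x;q,τ) ≥ δx²/(φ(q)(log log x)^C), V_Λ the
twisted class variance (inlined). Rev 5 supersedes the rev-3 body (stmt-Parity-18095: witness at ANY
x ≥ N), which the birth crux-attack kernel-checked to be ↔ (TwistedVarianceRate →
UniformRelativeDimOne) (evidence InverseDicksonUniformIff.lean on stmt-Parity-18095: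
¬TwistedVarianceRate hands ONE far-away failure family that witnesses EVERY anomaly). With the
window [N, N^B] that free direction is gone (a failure of TwistedVarianceRate along a sparse
sequence of scales no longer witnesses anomalies elsewhere), so the crux says what the thesis means:
anomalies of relative Dickson–Hardy–Littlewood are character/zero phenomena visible AT THEIR OWN
SCALE. Honest position (planner Sketch.lean, rc 0): S⁺ ⟹ this cr -/
@[route_item "route-Parity-VarianceWitness", crux]
def InverseDicksonUniform : Prop :=
  ∀ (A L : ℕ), ∀ ε : ℝ, 0 < ε → ∃ κ : ℝ, 0 < κ ∧ ∃ δ : ℝ, 0 < δ ∧ ∃ C : ℕ, ∃ B : ℕ, ∃ N₀ : ℕ, ∀ N : ℕ, N₀ ≤ N → ∀ t : ℕ, 1 ≤ t → (t : ℝ) ≤ Real.log (Real.log N) ^ A → ∀ Ψ : Fin t → Literature.NumberTheory.Sieve.AffLinForm 1, Literature.NumberTheory.Sieve.IsNondegenerateSystem Ψ → Literature.NumberTheory.Sieve.affLinSize Ψ N ≤ L * t → ∀ K : Set (Fin 1 → ℝ), Convex ℝ K → K ⊆ Literature.NumberTheory.Sieve.realBox 1 N → ε * (Literature.NumberTheory.Sieve.archFactor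 Ψ K * Literature.NumberTheory.Sieve.singularProduct Ψ + N) < |Literature.NumberTheory.Sieve.vonMangoldtSum Ψ K N - Literature.NumberTheory.Sieve.archFactor Ψ K * Literature.NumberTheory.Sieve.singularProduct Ψ| → ∃ x : ℕ, N ≤ x ∧ x ≤ N ^ B ∧ ∃ q : ℕ, 1 ≤ q ∧ (q : ℝ) ≤ (x : ℝ) ^ (1 - κ) ∧ ∃ τ : ℝ, |τ| ≤ x ∧ δ * (x : ℝ) ^ 2 / ((Nat.totient q : ℝ) * Real.log (Real.log x) ^ C) ≤ ∑ b ∈ (Finset.range q).filter (fun b => Nat.Coprime b q), ‖(∑ n ∈ (Finset.Icc 1 x).filter (fun n => n % q = b), (ArithmeticFunction.vonMangoldt n : ℂ) * Complex.exp (-(τ * Real.log n) * Complex.I)) - (∑ n ∈ (Finset.Icc 1 x).filter (fun n => Nat.Coprime n q), (ArithmeticFunction.vonMangoldt n : ℂ) * Complex.exp (-(τ * Real.log n) * Complex.I)) / (Nat.totient q : ℂ)‖ ^ 2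

/-- item stmt-Parity-18096 · crux · rank 3 · open · by planner
why it might fail: contains Landau–Siegel (exceptional χ mod q = x^{1/10} gives V ≍ x²/φ(q)) and more: (log q)^C zeros at 1 − O(log log q/log q), or ONE zero at 1 − A·log log log q/log q + iτ₀, cond ≤ x^{1−κ}, |τ₀| ≤ x, breaks it; open for every q > exp((log x)^{1/2}).
sources: Gallagher1970, GoldstonSuriajaya2021, FiorilliMartin2020, Hooley1975BDH1, FriedlanderGranvilleHildebrandMaier1991, MontgomeryVaughan2007
[crux] GRH-LITE WITH A LOG-LOG RATE (the zero side): for every κ, ε > 0 and every B : ℕ there is x₀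
with V_Λ(x;q,τ) ≤ ε x²/(φ(q)(log log x)^B) for all x ≥ x₀, 1 ≤ q ≤ x^{1−κ}, |τ| ≤ x
(individual-modulus Barban–Davenport–Halberstam, twisted, with a (log log x)^{−B} rate). Rev 3
supersedes UniformTwistedVariance (stmt-Parity-17130) = the case B = 0, which at τ = 0 is PROVABLY
implied by the typed conjunct (support ClassVarianceOfGHL) and refutes UnboundedSiegelZeros; GRH
gives every B with room x^{1−κ}(log x)^4(log log x)^B; in zero language, morally: no zeros of
L(s,χ), cond χ ≤ x^{1−κ}, |γ| ≤ x, with (1−β) log x = O(log log log x). [difficulty: open-problem] -/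
@[route_item "route-Parity-VarianceWitness", crux]
def TwistedVarianceRate : Prop :=
  ∀ κ : ℝ, 0 < κ → ∀ ε : ℝ, 0 < ε → ∀ B : ℕ, ∃ x₀ : ℕ, ∀ x : ℕ, x₀ ≤ x → ∀ q : ℕ, 1 ≤ q → (q : ℝ) ≤ (x : ℝ) ^ (1 - κ) → ∀ τ : ℝ, |τ| ≤ x → (∑ b ∈ (Finset.range q).filter (fun b => Nat.Coprime b q), ‖(∑ n ∈ (Finset.Icc 1 x).filter (fun n => n % q = b), (ArithmeticFunction.vonMangoldt n : ℂ) * Complex.exp (-(τ * Real.log n) * Complex.I)) - (∑ n ∈ (Finset.Icc 1 x).filter (fun n => Nat.Coprime n q), (ArithmeticFunction.vonMangoldt n : ℂ) * Complex.exp (-(τ * Real.log n) * Complex.I)) / (Nat.totient q : ℂ)‖ ^ 2) ≤ ε * (x : ℝ) ^ 2 / ((Nat.totient q : ℝ) * Real.log (Real.log x) ^ B)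

/-- item stmt-Parity-17132 · support · rank 9 · open · by planner
sources: GoldstonSuriajaya2021, GreenTao2010, FiorilliMartin2020
[support] THE CERTIFIED WALL (provable now, M/L): the typed conjunct implies the untwisted
class-variance law V_Λ(x;q) ≤ εx²/φ(q) for all q ≤ x^{1−κ} — by the tree's sharp Goldston–Suriajaya
identity `Literature.Barriers.Parity.residueSquareSum_eq` (Σ_b ψ(x;q,b)² = Σ_{n≤x}Λ(n)² + 2Σ_{k≤x,
q∣k} ψ₂(x,k)), GHL at (d,t,L) = (1,2,3) on each pair (n, n+k) over K = [1, x−k] (error ≤ ε′x per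
shift, 2ε′x²/q in total), the singular-series mean value Σ_{k≤x,q∣k}𝔖(k)(x−k) = x²/(2φ(q)) +
O((q/φ(q)) x log x) (GS2021 (Slast); upper half in tree: `sum_goldbachSingularSeries_mul_sub_le`),
Σ_{n≤x}Λ(n)² ≤ (x+1)log²x (tree) and ψ(x) ∼ x. Not a binder of `closes`; it certifies that crux 3 at
τ = 0 is NECESSARY ("GHL is GRH-lite-complete", sharpening the known Siegel cards). [difficulty:
provable-now] -/
@[route_item "route-Parity-VarianceWitness"]
def ClassVarianceOfGHL : Prop :=
  _root_.GeneralizedHardyLittlewood → ∀ κ : ℝ, 0 < κ → ∀ ε : ℝ, 0 < ε → ∃ x₀ : ℕ, ∀ x : ℕ, x₀ ≤ x → ∀ q : ℕ, 1 ≤ q → (q : ℝ) ≤ (x : ℝ) ^ (1 - κ) → (∑ b ∈ (Finset.range q).filter (fun b => Nat.Coprime b q), ((∑ n ∈ (Finset.Icc 1 x).filter (fun n => n % q = b), ArithmeticFunction.vonMangoldt n) - (∑ n ∈ (Finset.Icc 1 x).filter (fun n => Nat.Coprime n q), ArithmeticFunction.vonMangoldt n) / (Nat.totient q : ℝ)) ^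 2) ≤ ε * (x : ℝ) ^ 2 / (Nat.totient q : ℝ)

-- earlier AbsoluteUpgrade (stmt-Parity-14116, replaced 2026-08-17T09:32:55Z -> stmt-Parity-17977): open — RelativeDimOne → DimOne
/-- item stmt-Parity-17986 · support · rank 9 · open · by planner
sources: GreenTao2010, MatomakiMerikoski2023, Summits/Parity/GeneralizedHardyLittlewood/Theorems/LeeYangFibresAbsoluteUpgradeSummit.lean
[support] VESTIGIAL LINK DECL (rev 6; NOT an obligation of this route, NOT to be staffed): the
implication `RelativeDimOne → DimOne` with both sides INLINED verbatim (relative d = 1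
Dickson–Hardy–Littlewood with the Green–Tao Conj. 1.4 error ⟹ DimOne with absolute error εN),
definitionally equal to LeeYangFibres' residual `Theses.LeeYangFibres.AbsoluteUpgrade`
(stmt-Parity-14116; kernel-checked ≡ GeneralizedHardyLittlewood ∨ ¬RelativeDimOne in
Theorems/LeeYangFibresAbsoluteUpgradeSummit, whose every skeleton hides the summit). It exists ONLY
because that append-only Theorems file imports this route file and names
`Theses.VarianceWitness.AbsoluteUpgrade` (`varianceWitness_absoluteUpgrade_iff := Iff.rfl`,
`…_of_target := fun _ => h`; defeq of this inlined form re-checked in the planner's Sketch3.lean, rc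
0); it is off the cone of `closes` since rev 4, shares no item with stmt-Parity-14116 any more (so
that item's summit-hiding skeleton no longer attaches to this route), and is to be DROPPED by a
tenure planner the day an operator lane deletes the three `varianceWitness_*` theorems of that file.
Closes for free with stmt-Parity-0819 (`varianceWitness_absoluteUpgrade_of_target`). [diff -/
@[route_item "route-Parity-VarianceWitness"]
def AbsoluteUpgrade : Prop :=
  ∀ _ : (∀ (t L : ℕ), 1 ≤ t → ∀ ε : ℝ, 0 < ε → ∃ N₀ : ℕ, ∀ N : ℕ, N₀ ≤ N → ∀ Ψ : Fin t → Literature.NumberTheory.Sieve.AffLinForm 1, Literature.NumberTheory.Sieve.IsNondegenerateSystem Ψ → Literature.NumberTheory.Sieve.affLinSize Ψ N ≤ L → ∀ K : Set (Fin 1 → ℝ), Convex ℝ K → K ⊆ Literature.NumberTheory.Sieve.realBox 1 N → |Literature.NumberTheory.Sieve.vonMangoldtSum Ψ K N - Literature.NumberTheory.Sieve.archFactor Ψ K * Literature.NumberTheory.Sieve.singularProduct Ψ| ≤ ε * (Literature.NumberTheory.Sieve.archFactor Ψ K * Literature.NumberTheory.Sieve.singularProduct Ψ + N)), (∀ (t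 L : ℕ), 1 ≤ t → ∀ ε : ℝ, 0 < ε → ∃ N₀ : ℕ, ∀ N : ℕ, N₀ ≤ N → ∀ Ψ : Fin t → Literature.NumberTheory.Sieve.AffLinForm 1, Literature.NumberTheory.Sieve.IsNondegenerateSystem Ψ → Literature.NumberTheory.Sieve.affLinSize Ψ N ≤ L → ∀ K : Set (Fin 1 → ℝ), Convex ℝ K → K ⊆ Literature.NumberTheory.Sieve.realBox 1 N → |Literature.NumberTheory.Sieve.vonMangoldtSum Ψ K N - Literature.NumberTheory.Sieve.archFactor Ψ K * Literature.NumberTheory.Sieve.singularProduct Ψ| ≤ ε * (N : ℝ))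

/-- item stmt-Parity-18115 · support · rank 9 · closed · proved by Summit.Parity.GeneralizedHardyLittlewood.Theorems.uniformRelativeDimOne_of_cruxes @ 609a992d861b (planner) · by planner
[support] GLUE OF THE REGISTERED REDIRECT (provable now; bookkeeping, M): the route's two cruxes
give the target node S⁺ — InverseDicksonUniform → TwistedVarianceRate → UniformRelativeDimOne — by
contraposition through the witness: given (A, L, ε) take (κ, δ, C, B, N₀) from InverseDicksonUniform
and x₀ from TwistedVarianceRate at (κ, δ/2, C); for N ≥ max(N₀, x₀, 3) an anomaly of a t-system
would produce x ∈ [N, N^B] (so x ≥ 3, log log x > 0), q ≤ x^(1−κ), |τ| ≤ x with δx²/(φ(q)(log log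
x)^C) ≤ V_Λ(x;q,τ) ≤ (δ/2)x²/(φ(q)(log log x)^C), absurd. PROOF IN HAND: it is verbatim the body of
the certified deciding theorem `closes` minus the door binder, and it is the sorry-free assembly
`UniformRelativeDimOne_of` of the skeleton REGISTERED on the target item stmt-Parity-18098 (planner
file skel/UniformRelativeDimOne_split.lean, `ledger skeleton check` OK 2026-08-17T11:39Z, evidence
on stmt-Parity-18098) — a prover lands it as `theorem uniformRelativeDimOne_of_cruxes :
Theses.VarianceWitness.UniformRelativeDimOneOfCruxes` in a Theorems file importing only this route
file (30 lines, no new imports). WHY AN ITEM: it is the stated `cruxes → target` edge of the route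
(BC2 'restated is a redirec -/
@[route_item "route-Parity-VarianceWitness"]
def UniformRelativeDimOneOfCruxes : Prop :=
  InverseDicksonUniform → TwistedVarianceRate → UniformRelativeDimOne

-- `UniformRelativeDimOneOfCruxes` holds: proved by `Summit.Parity.GeneralizedHardyLittlewood.Theorems.uniformRelativeDimOne_of_cruxes` @ 609a992d861b (its module imports this route file, so no `_holds` link can be stated here).

/-- item stmt-Parity-18178 · support · rank 9 · open · by planner
sources: GreenTao2010, Summits/Parity/GeneralizedHardyLittlewood/Theorems/LeeYangFibresAbsoluteUpgradeUniformDoor.lean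
[support] THE AMPLIFICATION DOOR (provable now, ONE line; revs 3–12, restored at rev 14): S⁺ =
UniformRelativeDimOne implies the Statement — `fun h =>
Cruxes.AbsoluteUpgrade.UniformAmplification.generalizedHardyLittlewood_of_uniformRelativeDimOne h`
(Theorems/LeeYangFibresAbsoluteUpgradeUniformDoor.lean, p146814: tensor-power trick over
translate-constellations + m-uniform Gallagher averaging + the fibration lemma; the two copies of
S⁺, ours and `UniformAmplification.UniformRelativeDimOne`, agree by `Iff.rfl`). It is a HYPOTHESIS
of `closes` and not a by-name call because the door's file imports this route file (through
LeeYangFibresAbsoluteUpgradeSummit), and composing its VarianceWitness-free ingredients by name (rev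
13) needs seven LeeYangFibres Theorems imports whose module cone carries 30 unproved Literature
facts (ParityWave0, MoebiusShiftedPrimes, PolynomialCongruences, LevelOfDistribution,
LinearEquationsInPrimesTransference) — `blocked-by-cone` for every prover of the route — while none
of them is a constant of any item. LAND IT FIRST: `Theorems/VarianceWitnessUniformDoor.lean`
importing Theorems.LeeYangFibresAbsoluteUpgradeUniformDoor, `theorem uniformDoor_holds : Theses. -/
@[route_item "route-Parity-VarianceWitness", crux]
def UniformDoor : Prop :=
  UniformRelativeDimOne → _root_.GeneralizedHardyLittlewood

-- earlier Assembly (stmt-Parity-17134, replaced 2026-08-17T08:11:50Z -> stmt-Parity-18097): retired by None — InverseDickson → UniformTwistedVariance → AbsoluteUpgrade → FibrationLemma → _root_.GeneralizedHardyLittlewood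
-- earlier Assembly (stmt-Parity-18097, replaced 2026-08-17T12:37:37Z -> stmt-Parity-18100): retired by None — InverseDicksonUniform → TwistedVarianceRate → UniformDoor → _root_.GeneralizedHardyLittlewood
/-- item stmt-Parity-18100 · assembly · rank 1 · open · by planner
sources: GreenTao2010
[assembly] InverseDicksonUniform → TwistedVarianceRate → GeneralizedHardyLittlewood — the type of
the deciding theorem `closes` (rev 13: the two t-uniform cruxes give S⁺ by contraposition through
the witness; the door S⁺ → DimOne → Statement is composed BY NAME from landed theorems inside
`closes`; no support binder, no declared residual). -/
@[route_item "route-Parity-VarianceWitness"]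
def Assembly : Prop :=
  InverseDicksonUniform → TwistedVarianceRate → _root_.GeneralizedHardyLittlewood

-- records of items no longer active in this route (dropped / restated):
-- earlier InverseDickson (stmt-Parity-17129, replaced 2026-08-17T08:11:50Z -> stmt-Parity-18095): retired by None — ∀ (t L : ℕ), 1 ≤ t → ∀ ε : ℝ, 0 < ε → ∃ κ : ℝ, 0 < κ ∧ ∃ δ : ℝ, 0 < δ ∧ ∃ N₀ : ℕ, ∀ N : ℕ, N₀ ≤ N → ∀ Ψ : Fin t → Literature.NumberTheory.Sieve.AffLinForm 1, Literature.NumberTheory.Sieve.IsNondegenerateSystem Ψ → Literature.NumberTheory.Sieve.affLinSize Ψ N ≤ L → ∀ K : Set (Fin 1 → ℝ)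
-- earlier UniformTwistedVariance (stmt-Parity-17130, replaced 2026-08-17T08:11:50Z -> stmt-Parity-18096): retired by None — ∀ κ : ℝ, 0 < κ → ∀ ε : ℝ, 0 < ε → ∃ x₀ : ℕ, ∀ x : ℕ, x₀ ≤ x → ∀ q : ℕ, 1 ≤ q → (q : ℝ) ≤ (x : ℝ) ^ (1 - κ) → ∀ τ : ℝ, |τ| ≤ x → (∑ b ∈ (Finset.range q).filter (fun b => Nat.Coprime b q), ‖(∑ n ∈ (Finset.Icc 1 x).filter (fun n => n % q = b), (ArithmeticFunction.vonMangoldt n : ℂ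

/-! D-0027 §2.1 — DECIDING THEOREM (planner-authored via `route open/edit --closes-file`; by planner-rbadge-Parity-VarianceWitness-75000cea-g7-0 2026-08-17T13:30:24Z):
its hypotheses are this route's items and its conclusion the sub-problem Statement (glue_lint), and it elaborates with this file. -/

@[closes "route-Parity-VarianceWitness"] theorem closes (hI : InverseDicksonUniform) (hV : TwistedVarianceRate) (hD : UniformDoor) :
    _root_.GeneralizedHardyLittlewood := by
  -- (1) the door S⁺ = UniformRelativeDimOne ⟹ Statement is the provable-now SUPPORT binder `hD`: one line from the
  --     LANDED `Cruxes.AbsoluteUpgrade.UniformAmplification.generalizedHardyLittlewood_of_uniformRelativeDimOne`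
  --     (Theorems/LeeYangFibresAbsoluteUpgradeUniformDoor.lean, p146814), whose file imports this route file — so it is
  --     a hypothesis here and a Theorems obligation (land-ready proof attached to the item). Rev 14 restores this
  --     rev-3…12 shape: composing the door BY NAME (rev 13) needs seven LeeYangFibres Theorems imports whose module
  --     cone (173 modules) carries 30 unproved Literature facts ⇒ `blocked-by-cone` for provers; with the binder the
  --     route file imports only `Literature.NumberTheory.Sieve.LinearEquationsInPrimes` (module cone 10, 0 unproved).
  -- (2) S⁺ from the two cruxes by contraposition through the LOCALIZED witness (InverseDicksonUniform, rev 5: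
  --     x ∈ [N, N^B]) against the zero side TwistedVarianceRate at (κ, δ/2, C).
  refine hD ?_
  intro A L ε hε
  obtain ⟨κ, hκ, δ, hδ, C, B, N₀, hN₀⟩ := hI A L ε hε
  obtain ⟨x₀, hx₀⟩ := hV κ hκ (δ / 2) (by positivity) C
  refine ⟨max (max N₀ x₀) 3, fun N hN t ht htA Ψ hΨ hL K hK hKN => ?_⟩
  have hN₀N : N₀ ≤ N := le_trans (le_trans (le_max_left _ _) (le_max_left _ _)) hN
  have hx₀N : x₀ ≤ N := le_trans (le_trans (le_max_right _ _) (le_max_left _ _)) hN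
  have h3N : 3 ≤ N := le_trans (le_max_right _ _) hN
  by_contra hcon
  rw [not_le] at hcon
  obtain ⟨x, hNx, -, q, hq1, hqx, τ, hτ, hwit⟩ := hN₀ N hN₀N t ht htA Ψ hΨ hL K hK hKN hcon
  have hbound := hx₀ x (le_trans hx₀N hNx) q hq1 hqx τ hτ
  have hx3 : (3 : ℝ) ≤ (x : ℝ) := by exact_mod_cast le_trans h3N hNx
  have hxpos : (0 : ℝ) < (x : ℝ) := by linarith
  have hlog : (1 : ℝ) < Real.log (x : ℝ) := by
    rw [Real.lt_log_iff_exp_lt hxpos]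
    exact lt_of_lt_of_le Real.exp_one_lt_three hx3
  have hll : (0 : ℝ) < Real.log (Real.log (x : ℝ)) := Real.log_pos hlog
  have hφpos : (0 : ℝ) < (Nat.totient q : ℝ) := by
    exact_mod_cast Nat.totient_pos.mpr (by omega)
  have hD' : (0 : ℝ) < (Nat.totient q : ℝ) * Real.log (Real.log (x : ℝ)) ^ C :=
    mul_pos hφpos (pow_pos hll C)
  have hlt : δ / 2 * (x : ℝ) ^ 2 / ((Nat.totient q : ℝ) * Real.log (Real.log (x : ℝ)) ^ C) <
      δ * (x : ℝ) ^ 2 / ((Nat.totient q : ℝ) * Real.log (Real.log (x : ℝ)) ^ C) := by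
    have hx2 : (0 : ℝ) < (x : ℝ) ^ 2 := by positivity
    rw [div_lt_div_iff_of_pos_right hD']
    nlinarith
  linarith

end Summit.Parity.GeneralizedHardyLittlewood.Theses.VarianceWitness
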